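/-
HONEST FRAMING: certified error envelopes and provably optimal rounding/accumulation schemes for
low-precision formats under stated cost models; every table by two implementations; no hardware
or vendor claims.
-/
import Summits.Ventures.CertifiedArithmetic.LowPrec.OptDemotionGoodActiveCex

/-!
# The demotion law (Theorem T8), part 6f: the two secant properties MONO and W

Part 6e refuted GOOD-ACTIVE (opt's single-tree input for the all-tree node step of Conjecture D).
The lean seat's gen-10 analysis (HOME `CONJECTURE-D-NODESTEP.md` §G10, scripts
`code/lean/demote_g10/`) reduces the node step of the full-family cap invariant at a node `a·b` to
TWO single-tree envelope inequalities on the children — both *secant* consequences of GOOD-ACTIVE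
that survive every known GOOD-ACTIVE failure:

* **MONO** (opt's (R9)(2)(ii)): for a one-bit `ε ≥ 2u`, `k ≥ 1`, `x = ε(2k+1) < 1`, `w = 1 + 2εk`:
  `Q_t^(x) ≤ w · Q_t^(ε/w)` (`Q_t^(ρ) = treeQf u t ρ`), i.e. the cap of a subtree read at its TRUE
  scale is below its pseudo-scale reading with the lowest set bit of the excess as the excess;
* **W** (new): for every grid excess `y` with `2y + 2u < 1`, `β = ufp(y+u)`, `β(1+ξ) = y + u`:
  `(1-u)·G_t(2y+2u) ≤ G_t(y) + (1-2u)·β·G_t(ξ)` (`G_t(ρ) = Q_t^(ρ) - 1 - ρ`), i.e. the "window" of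
  sibling weights escaping both the straight and the transposed cover of the configuration
  "`t` at the top of the lower binade, sibling exactly at a power of two" is EMPTY.

THIS FILE (definitions + the cheap facts; the node lemma itself is future work):
* `treeQMQ` — linear-time simultaneous evaluation of `(M_t, Q_t^(ρ), Q_t^(u/ρ))` and its
  correctness `treeQMQ_spec` (the plain recursion `treeQf` is exponential in the height);
* `MonoPt`/`WPt` (one point) and `MonoTree q t`/`WTree q t` (all grid points at precision `q`), with
  computable twins `MonoTreeC`/`WTreeC` (via `treeQMQ`) and the equivalences;
* `exists_line_of_monoPt` — the line form used by a node lemma: every line of `L_t` at `x` is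
  dominated by some line read at `(w, ε)`;
* `monoPt_of_goodActiveAt`, `wPt_of_goodActiveAt` — GOOD-ACTIVE at the high point implies MONO resp.
  W there WITH THE SAME LINE (so MONO ∧ W is pointwise weaker than GOOD-ACTIVE), hence
  `monoTree_of_uBalanced`, `wTree_of_uBalanced` (every u-balanced tree, e.g. every perfect tree);
* kernel certificates: `opt37` (opt gen 11's 37-leaf tree) has `¬ GoodActiveTree 4 opt37` — so
  `¬ GoodActive 4` (`not_goodActive_four`, the `q = 4` companion of part 6e) — yet
  `MonoTreeC 4 opt37 ∧ WTreeC 4 opt37`; and part 6e's `gaCex43` has `MonoTreeC 5 gaCex43 ∧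
  WTreeC 5 gaCex43` (`decide +kernel`, no `native_decide`).
Numerics behind the reduction (exact rationals, implementation in `code/lean/demote_g10/`): MONO and
W hold for every tree tested (`q = 3..6`, all shapes `n ≤ 9`, > 10³ random trees up to 60 leaves,
all seven GOOD-ACTIVE-failure trees); the node step with caps holds in > 6·10⁵ configurations.
-/

namespace Summit.Ventures.CertifiedArithmetic.LowPrec.Opt

open Literature.ComputerArithmetic.JeannerodRump2018
open Literature.ComputerArithmetic.JeannerodRump2018.SumTree

/-! ## Linear-time evaluation of the coupled polynomial -/

/-- `(M_t, Q_t^(ρ), Q_t^(u/ρ))` computed bottom-up in ONE pass (the arguments of `treeQf` alternate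
between `ρ` and `u/ρ`, and `u/(u/ρ) = ρ`). -/
def treeQMQ (u : ℚ) : SumTree → ℚ → ℚ × ℚ × ℚ
  | .leaf _, ρ => (1, 1 + ρ, 1 + u / ρ)
  | .node a b, ρ =>
      let A := treeQMQ u a ρ
      let B := treeQMQ u b ρ
      (max A.1 B.1 + u * min A.1 B.1,
       max (max (A.2.1 + u * B.1) (B.2.1 + u * A.1)) (max (A.1 + ρ * B.2.2) (B.1 + ρ * A.2.2)),
       max (max (A.2.2 + u * B.1) (B.2.2 + u * A.1))
           (max (A.1 + (u / ρ) * B.2.1) (B.1 + (u / ρ) * A.2.1)))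

/-- `u/(u/ρ) = ρ` for `u ≠ 0` (also at `ρ = 0` with Lean's `x/0 = 0`). -/
theorem div_div_self_cancel {u : ℚ} (hu : u ≠ 0) (ρ : ℚ) : u / (u / ρ) = ρ := by
  rcases eq_or_ne ρ 0 with h | h
  · subst h; simp
  · field_simp

/-- Correctness of the one-pass evaluation. -/
theorem treeQMQ_spec {u : ℚ} (hu : u ≠ 0) :
    ∀ (t : SumTree) (ρ : ℚ), treeQMQ u t ρ = (treeM u t, treeQf u t ρ, treeQf u t (u / ρ))
  | .leaf x, ρ => by simp [treeQMQ]
  | .node a b, ρ => by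
      have ha := treeQMQ_spec hu a ρ
      have hb := treeQMQ_spec hu b ρ
      simp only [treeQMQ, ha, hb, treeM_node, treeQf_node, div_div_self_cancel hu ρ]

/-- The envelope of the full line family: `G_t(ρ) = Q_t^(ρ) - 1 - ρ` (part 6a (R7)). -/
def envG (u : ℚ) (t : SumTree) (ρ : ℚ) : ℚ := treeQf u t ρ - 1 - ρ

/-! ## MONO and W, one point -/

/-- **MONO at `(ε, k)`**: `Q_t^(ε(2k+1)) ≤ (1+2εk) · Q_t^(ε/(1+2εk))`. -/
def MonoPt (u : ℚ) (t : SumTree) (ε : ℚ) (k : ℕ) : Prop :=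
  treeQf u t (ε * (2 * k + 1)) ≤ (1 + 2 * ε * k) * treeQf u t (ε / (1 + 2 * ε * k))

/-- **W at `y`** (with the binade data `β = ufp(y+u)`, `ξ = (y+u)/β - 1` supplied explicitly):
`(1-u)·G_t(2y+2u) ≤ G_t(y) + (1-2u)·β·G_t(ξ)`. -/
def WPt (u : ℚ) (t : SumTree) (y β ξ : ℚ) : Prop :=
  (1 - u) * envG u t (2 * y + 2 * u) ≤ envG u t y + (1 - 2 * u) * β * envG u t ξ

/-- Computable twin of `MonoPt` (one-pass evaluation). -/
def monoPtC (u : ℚ) (t : SumTree) (ε : ℚ) (k : ℕ) : Bool :=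
  decide ((treeQMQ u t (ε * (2 * k + 1))).2.1
    ≤ (1 + 2 * ε * k) * (treeQMQ u t (ε / (1 + 2 * ε * k))).2.1)

/-- Computable twin of `WPt`. -/
def wPtC (u : ℚ) (t : SumTree) (y β ξ : ℚ) : Bool :=
  decide ((1 - u) * ((treeQMQ u t (2 * y + 2 * u)).2.1 - 1 - (2 * y + 2 * u))
    ≤ ((treeQMQ u t y).2.1 - 1 - y) + (1 - 2 * u) * β * ((treeQMQ u t ξ).2.1 - 1 - ξ))

/-- The computable twin agrees with `MonoPt`. -/
theorem monoPtC_iff {u : ℚ} (hu : u ≠ 0) (t : SumTree) (ε : ℚ) (k : ℕ) :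
    monoPtC u t ε k = true ↔ MonoPt u t ε k := by
  simp only [monoPtC, treeQMQ_spec hu, MonoPt, decide_eq_true_eq]

/-- The computable twin agrees with `WPt`. -/
theorem wPtC_iff {u : ℚ} (hu : u ≠ 0) (t : SumTree) (y β ξ : ℚ) :
    wPtC u t y β ξ = true ↔ WPt u t y β ξ := by
  simp only [wPtC, treeQMQ_spec hu, WPt, envG, decide_eq_true_eq]

/-! ## All grid points at precision `q` -/

/-- `ufp` data of the odd multiple `(2j+1)·u`: `β = 2^⌊log₂(2j+1)⌋ · u` and `ξ = (2j+1)u/β - 1`. -/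
def betaOf (u : ℚ) (j : ℕ) : ℚ := (2 : ℚ) ^ (Nat.log2 (2 * j + 1)) * u

/-- **MONO for the tree `t` at precision `q`**: every one-bit `ε = 2^{-m} ≥ 2u` (`1 ≤ m ≤ q-1`) and
every `k ≥ 1` with `ε(2k+1) < 1`. -/
def MonoTree (q : ℕ) (t : SumTree) : Prop :=
  ∀ m : ℕ, m < q → 1 ≤ m → ∀ k : ℕ, k < 2 ^ q → 1 ≤ k →
    (1 / (2 : ℚ) ^ m) * (2 * (k : ℚ) + 1) < 1 → MonoPt (unitRoundoff q) t (1 / (2 : ℚ) ^ m) k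

/-- **W for the tree `t` at precision `q`**: every grid excess `y = 2ju` with `2y + 2u < 1`. -/
def WTree (q : ℕ) (t : SumTree) : Prop :=
  ∀ j : ℕ, j < 2 ^ q → 2 * (2 * (j : ℚ) * unitRoundoff q) + 2 * unitRoundoff q < 1 →
    WPt (unitRoundoff q) t (2 * (j : ℚ) * unitRoundoff q) (betaOf (unitRoundoff q) j)
      ((2 * (j : ℚ) + 1) * unitRoundoff q / betaOf (unitRoundoff q) j - 1)

/-- Computable twin of `MonoTree`. -/
def MonoTreeC (q : ℕ) (t : SumTree) : Prop :=
  ∀ m : ℕ, m < q → 1 ≤ m → ∀ k : ℕ, k < 2 ^ q → 1 ≤ k →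
    (1 / (2 : ℚ) ^ m) * (2 * (k : ℚ) + 1) < 1 → monoPtC (unitRoundoff q) t (1 / (2 : ℚ) ^ m) k = true

/-- Computable twin of `WTree`. -/
def WTreeC (q : ℕ) (t : SumTree) : Prop :=
  ∀ j : ℕ, j < 2 ^ q → 2 * (2 * (j : ℚ) * unitRoundoff q) + 2 * unitRoundoff q < 1 →
    wPtC (unitRoundoff q) t (2 * (j : ℚ) * unitRoundoff q) (betaOf (unitRoundoff q) j)
      ((2 * (j : ℚ) + 1) * unitRoundoff q / betaOf (unitRoundoff q) j - 1) = true

/-- `MonoTreeC` is decidable (bounded quantifiers over a Boolean test). -/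
instance (q : ℕ) (t : SumTree) : Decidable (MonoTreeC q t) := by unfold MonoTreeC; infer_instance
/-- `WTreeC` is decidable. -/
instance (q : ℕ) (t : SumTree) : Decidable (WTreeC q t) := by unfold WTreeC; infer_instance

/-- `u_q ≠ 0`. -/
theorem unitRoundoff_ne_zero (q : ℕ) : unitRoundoff q ≠ 0 := by
  unfold unitRoundoff; positivity

/-- `MonoTreeC ↔ MonoTree`. -/
theorem monoTreeC_iff (q : ℕ) (t : SumTree) : MonoTreeC q t ↔ MonoTree q t := by
  simp only [MonoTreeC, MonoTree, monoPtC_iff (unitRoundoff_ne_zero q)]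

/-- `WTreeC ↔ WTree`. -/
theorem wTreeC_iff (q : ℕ) (t : SumTree) : WTreeC q t ↔ WTree q t := by
  simp only [WTreeC, WTree, wPtC_iff (unitRoundoff_ne_zero q)]

/-- sanity: the balanced four-leaf tree at `q = 4`. -/
example : MonoTreeC 4 (.node (.node (.leaf 0) (.leaf 0)) (.node (.leaf 0) (.leaf 0))) ∧
    WTreeC 4 (.node (.node (.leaf 0) (.leaf 0)) (.node (.leaf 0) (.leaf 0))) := by
  decide +kernel


/-! ## Line forms and the comparison with GOOD-ACTIVE -/

/-- MONO in LINE FORM (what a node lemma consumes): at `x = ε(2k+1)` every line of `L_t` is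
dominated by some line of `L_t` read at pseudo-scale `w = 1+2εk` with excess `ε`. -/
theorem exists_line_of_monoPt {u : ℚ} (hu : 0 < u) (hu1 : u ≤ 1) (t : SumTree) {ε : ℚ} (hε : 0 < ε)
    {k : ℕ} (h : MonoPt u t ε k) {l : ℚ × ℚ} (hl : l ∈ allLines u t) :
    ∃ l' ∈ allLines u t,
      l.1 + l.2 * (ε * (2 * k + 1)) ≤ l'.1 * (1 + 2 * ε * k) + l'.2 * ε := by
  have hk : (0 : ℚ) ≤ k := Nat.cast_nonneg k
  have hw : 0 < 1 + 2 * ε * k := by positivity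
  have hx : 0 ≤ ε * (2 * k + 1) := by positivity
  obtain ⟨l', hl', he⟩ := exists_allLine_eq_treeQf hu t (ε / (1 + 2 * ε * k)) (div_pos hε hw)
  refine ⟨l', hl', ?_⟩
  have h1 := allLine_le_treeQf_of_nonneg hu hu1 t hl hx
  unfold MonoPt at h
  have e : (1 + 2 * ε * k) * treeQf u t (ε / (1 + 2 * ε * k))
      = (1 + 2 * ε * k) + ε + l'.1 * (1 + 2 * ε * k) + l'.2 * ε := by
    rw [← he]; field_simp
  linarith

/-- Conversely the line form gives `MonoPt`. -/
theorem monoPt_of_lines {u : ℚ} (hu : 0 < u) (t : SumTree) {ε : ℚ} (hε : 0 < ε)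
    {k : ℕ} (h : ∀ l ∈ allLines u t, ∃ l' ∈ allLines u t,
      l.1 + l.2 * (ε * (2 * k + 1)) ≤ l'.1 * (1 + 2 * ε * k) + l'.2 * ε) :
    MonoPt u t ε k := by
  have hk : (0 : ℚ) ≤ k := Nat.cast_nonneg k
  have hw : 0 < 1 + 2 * ε * k := by positivity
  have hx : 0 < ε * (2 * k + 1) := by positivity
  obtain ⟨l, hl, he⟩ := exists_allLine_eq_treeQf hu t (ε * (2 * k + 1)) hx
  obtain ⟨l', hl', hle⟩ := h l hl
  have h1 := allLine_le_treeQf hu t l' hl' (ε / (1 + 2 * ε * k)) (div_pos hε hw)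
  unfold MonoPt
  have e : (1 + 2 * ε * k) * (1 + ε / (1 + 2 * ε * k) + l'.1 + l'.2 * (ε / (1 + 2 * ε * k)))
      = (1 + 2 * ε * k) + ε + l'.1 * (1 + 2 * ε * k) + l'.2 * ε := by
    field_simp
  have h2 := mul_le_mul_of_nonneg_left h1 hw.le
  rw [e] at h2
  linarith

/-- **GOOD-ACTIVE at the point implies MONO there, with the same line.** -/
theorem monoPt_of_goodActiveAt {u : ℚ} (hu : 0 < u) (t : SumTree) {ε : ℚ}
    (hε : 0 < ε) {k : ℕ} (hG : GoodActiveAt u t (ε * (2 * k + 1))) : MonoPt u t ε k := by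
  refine monoPt_of_lines hu t hε fun l hl => ?_
  obtain ⟨l', hl', hgood, hle⟩ := hG l hl
  refine ⟨l', hl', le_trans hle ?_⟩
  have hk : (0 : ℚ) ≤ k := Nat.cast_nonneg k
  nlinarith [mul_nonneg (mul_nonneg hε.le hk) (sub_nonneg.2 hgood)]

/-- **GOOD-ACTIVE at the high point `2y+2u` implies W at `y`, with the same line**, for ANY
`β, ξ ≥ 0` with `β(1+ξ) = y+u` (in particular the true scale `β = ufp(y+u)`); `u ≤ 1/2`. -/
theorem wPt_of_goodActiveAt {u : ℚ} (hu : 0 < u) (hu2 : u ≤ 1 / 2) (t : SumTree) {y β ξ : ℚ}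
    (hy : 0 ≤ y) (hβ : 0 ≤ β) (hξ : 0 ≤ ξ) (hrel : β * (1 + ξ) = y + u)
    (hG : GoodActiveAt u t (2 * y + 2 * u)) : WPt u t y β ξ := by
  have hu1 : u ≤ 1 := by linarith
  have hz : 0 < 2 * y + 2 * u := by positivity
  obtain ⟨l, hl, he⟩ := exists_allLine_eq_treeQf hu t (2 * y + 2 * u) hz
  obtain ⟨l', hl', hgood, hle⟩ := hG l hl
  have h1 := allLine_le_treeQf_of_nonneg hu hu1 t hl' hy
  have h2 := allLine_le_treeQf_of_nonneg hu hu1 t hl' hξ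
  unfold WPt envG
  have key : (1 - u) * (l'.1 + l'.2 * (2 * y + 2 * u))
      ≤ (l'.1 + l'.2 * y) + (1 - 2 * u) * β * (l'.1 + l'.2 * ξ) := by
    have hcoef : 0 ≤ u + β * (1 - 2 * u) := by nlinarith
    have e : (l'.1 + l'.2 * y) + (1 - 2 * u) * β * (l'.1 + l'.2 * ξ)
        - (1 - u) * (l'.1 + l'.2 * (2 * y + 2 * u)) = (l'.1 - l'.2) * (u + β * (1 - 2 * u)) := by
      have hbx : β * ξ = y + u - β := by linarith
      rw [show (1 - 2 * u) * β * (l'.1 + l'.2 * ξ) = (1 - 2 * u) * (β * l'.1 + l'.2 * (β * ξ)) by ring,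
        hbx]
      ring
    nlinarith [mul_nonneg (sub_nonneg.2 hgood) hcoef]
  have h12u : 0 ≤ (1 - 2 * u) * β := mul_nonneg (by linarith) hβ
  nlinarith [mul_le_mul_of_nonneg_left h2 h12u]

/-- In a u-balanced tree every line is good, so GOOD-ACTIVE holds at every real excess. -/
theorem goodActiveAt_of_uBalanced {u : ℚ} (hu0 : 0 ≤ u) (hu1 : u ≤ 1) {t : SumTree}
    (ht : UBalanced u t) (x : ℚ) : GoodActiveAt u t x :=
  fun l hl => ⟨l, hl, allLines_good_of_uBalanced hu0 hu1 t ht l hl, le_rfl⟩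

/-- `u_q ≤ 1/2` for `q ≥ 1`. -/
theorem unitRoundoff_le_half {q : ℕ} (hq : 1 ≤ q) : unitRoundoff q ≤ 1 / 2 := by
  unfold unitRoundoff
  have : (2 : ℚ) ≤ 2 ^ q := by
    calc (2 : ℚ) = 2 ^ 1 := by norm_num
      _ ≤ 2 ^ q := pow_le_pow_right₀ (by norm_num) hq
  exact one_div_le_one_div_of_le (by norm_num) this

/-- **MONO holds for every u-balanced tree** (⊇ every perfect tree of every height). -/
theorem monoTree_of_uBalanced {q : ℕ} {t : SumTree} (ht : UBalanced (unitRoundoff q) t) :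
    MonoTree q t := by
  intro m _ _ k _ _ _
  have hu : 0 < unitRoundoff q := by unfold unitRoundoff; positivity
  exact monoPt_of_goodActiveAt hu t (by positivity)
    (goodActiveAt_of_uBalanced (unitRoundoff_nonneg q) (unitRoundoff_le_one q) ht _)

/-- `0 < β`. -/
theorem betaOf_pos {u : ℚ} (hu : 0 < u) (j : ℕ) : 0 < betaOf u j := by
  unfold betaOf; positivity

/-- `β ≤ (2j+1)u` (so `ξ ≥ 0`). -/
theorem betaOf_le {u : ℚ} (hu : 0 < u) (j : ℕ) : betaOf u j ≤ (2 * (j : ℚ) + 1) * u := by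
  unfold betaOf
  have h : (2 : ℕ) ^ Nat.log2 (2 * j + 1) ≤ 2 * j + 1 := Nat.log2_self_le (by omega)
  have h' : ((2 : ℕ) ^ Nat.log2 (2 * j + 1) : ℚ) ≤ ((2 * j + 1 : ℕ) : ℚ) := by exact_mod_cast h
  push_cast at h'
  exact mul_le_mul_of_nonneg_right h' hu.le

/-- **W holds for every u-balanced tree.** -/
theorem wTree_of_uBalanced {q : ℕ} (hq : 1 ≤ q) {t : SumTree} (ht : UBalanced (unitRoundoff q) t) :
    WTree q t := by
  intro j _ _
  have hu : 0 < unitRoundoff q := by unfold unitRoundoff; positivity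
  have hβ := betaOf_pos hu j
  have hβle := betaOf_le hu j
  refine wPt_of_goodActiveAt hu (unitRoundoff_le_half hq) t (by positivity) hβ.le ?_ ?_
    (goodActiveAt_of_uBalanced (unitRoundoff_nonneg q) (unitRoundoff_le_one q) ht _)
  · rw [sub_nonneg, le_div_iff₀ hβ]; linarith
  · field_simp
    ring

/-! ## Kernel certificates: the GOOD-ACTIVE failures satisfy MONO and W -/

/-- Leaf. -/
private def pL : SumTree := .leaf 0
/-- Node. -/
private def pN (a b : SumTree) : SumTree := .node a b

/-- OPT gen 11's 37-leaf GOOD-ACTIVE failure (`pub-lowprec-opt/gen11/gafail_q4.txt`), height 12,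
`M_t(1/16) = 7447/4096`:
`((((((((((..).).).).).).)(..)).)(((.(((.(((..).).)).).))(((.(.((..).))).).))(.(((.(((.((.(..)).)).).)).).))))`. -/
def opt37 : SumTree :=
  (pN (pN (pN (pN (pN (pN (pN (pN (pN (pN pL pL) pL) pL) pL) pL) pL) pL) (pN pL pL)) pL) (pN (pN (pN pL (pN (pN (pN pL (pN (pN (pN pL pL) pL) pL)) pL) pL)) (pN (pN (pN pL (pN pL (pN (pN pL pL) pL))) pL) pL)) (pN pL (pN (pN (pN pL (pN (pN (pN pL (pN (pN pL (pN pL pL)) pL)) pL) pL)) pL) pL))))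

/-- KERNEL FACTS at `u = 1/16`, `x = 7/8 = 1 - 2u`: the bad line `(169/256, 91/128)` is a member of
the full family of `opt37` and every GOOD member is strictly below it at `x = 7/8` (the best good
value is `2619/2048 = 1313/1024 - 7/2048`); `decide +kernel` over the 19 948-line family. -/
theorem opt37_facts :
    ((169 : ℚ) / 256, (91 : ℚ) / 128) ∈ allLines (1 / 16) opt37 ∧
    ∀ l' ∈ allLines (1 / 16) opt37, l'.2 ≤ l'.1 →
      l'.1 + l'.2 * ((7 : ℚ) / 8) < 169 / 256 + 91 / 128 * ((7 : ℚ) / 8) := by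
  decide +kernel

/-- `u_4 = 1/16`. -/
theorem unitRoundoff_four : unitRoundoff 4 = 1 / 16 := by norm_num [unitRoundoff]

/-- **GOOD-ACTIVE FAILS for `opt37` at precision 4** (grid excess `x = 2·7·u_4 = 7/8`). -/
theorem not_goodActiveTree_opt37 : ¬ GoodActiveTree 4 opt37 := by
  intro h
  have hk : ((7 : ℕ) : ℚ) * (2 * unitRoundoff 4) < 1 := by rw [unitRoundoff_four]; norm_num
  have hx : ((7 : ℕ) : ℚ) * (2 * unitRoundoff 4) = (7 : ℚ) / 8 := by
    rw [unitRoundoff_four]; norm_num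
  obtain ⟨hmem, hdom⟩ := opt37_facts
  have h1 := h 7 hk
  rw [hx, unitRoundoff_four] at h1
  obtain ⟨l', hl', hgood, hle⟩ := h1 _ hmem
  have hlt := hdom l' hl' hgood
  dsimp only at hle
  linarith

/-- **`GoodActive 4` IS FALSE** (the `q = 4` companion of part 6e's `not_goodActive_five`). -/
theorem not_goodActive_four : ¬ GoodActive 4 :=
  fun h => not_goodActiveTree_opt37 ((goodActive_iff 4).mp h opt37)

/-- **… yet `opt37` satisfies MONO and W at precision 4** (all grid points; `decide +kernel` through
the linear-time evaluator). -/
theorem monoW_opt37 : MonoTreeC 4 opt37 ∧ WTreeC 4 opt37 := by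
  decide +kernel

/-- `opt37` satisfies MONO and W at precision 4 (propositional form). -/
theorem monoTree_wTree_opt37 : MonoTree 4 opt37 ∧ WTree 4 opt37 :=
  ⟨(monoTreeC_iff 4 opt37).mp monoW_opt37.1, (wTreeC_iff 4 opt37).mp monoW_opt37.2⟩

/-- **Part 6e's `gaCex43` (`¬ GoodActiveTree 5 gaCex43`) satisfies MONO and W at precision 5.** -/
theorem monoW_gaCex43 : MonoTreeC 5 gaCex43 ∧ WTreeC 5 gaCex43 := by
  decide +kernel

/-- `gaCex43` satisfies MONO and W at precision 5 (propositional form). -/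
theorem monoTree_wTree_gaCex43 : MonoTree 5 gaCex43 ∧ WTree 5 gaCex43 :=
  ⟨(monoTreeC_iff 5 gaCex43).mp monoW_gaCex43.1, (wTreeC_iff 5 gaCex43).mp monoW_gaCex43.2⟩

end Summit.Ventures.CertifiedArithmetic.LowPrec.Opt
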